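import Summits.BirchSwinnertonDyer.BirchSwinnertonDyer.Theorems.ManinLocalTwoThreeKummerDiamondIndexFourShapeFlat
import Summits.BirchSwinnertonDyer.BirchSwinnertonDyer.Theorems.ManinLocalTwoThreeFlatGamma1Datum
import HarnessLib

/-!
# C2 `ManinOddAtFour` modulo TWO printed facts {CDT, T-es-75}: CES is not needed (the flat `X₁(N)`-datum)
(route `ManinLocalTwoThree`, crux C2 `ManinOddAtFour` stmt-BirchSwinnertonDyer-22967; cell bsd-f2-manin, prover seat p2 gen 22;
`--supports stmt-BirchSwinnertonDyer-22967`; sequel of the LEAD's `…KummerDiamondIndexFourShapeFlat` (p1 gen 20) and of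
`…FlatGamma1Datum` (p2 gen 22))

The LEAD's flat assembly `two_pow_five_dvd_and_hasFreyTwistShape_of_index_four_of_twoTorsion` (E-es-185♭ ⟸ CES ∧ T-es-75) consumes
the printed existence fact CES (`exists_optimal_gamma1ParametrizationData`: some curve of the class carries an optimal `X₁(N)`-datum)
at exactly two places, both through THEOREM K (es `indexFour_kummerDiamondReciprocity` ⟸ T-es-75 ∧ CES): the Kummer values
`σ(S_y) − S_y = π₀(c₀{∞,γ∞}/2)` fed to PROPOSITION A, and the fixedness of the Atkin–Lehner points `R_y` (THEOREM K doubled).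
In E-es-185♭'s world (`|c₀| = 2`, `Λ₁(f) = 2Λ₀(f)`) the `X₀(N)`-optimal curve `W₀` ITSELF carries an optimal `X₁(N)`-datum
(`FlatGamma1Datum.exists_flat_gamma1ParametrizationData`: `Λ_{W₀} = c₀Λ₀ = (c₀/2)Λ₁`, same `f`, same `π₀`), so THEOREM K♮
(es `kummerDiamondReciprocity`, ⟸ T-es-75 alone) applies to it directly — no isogeny, no lattice transfer, no CES.

* §1 `two_pow_five_dvd_and_hasFreyTwistShape_of_kummerValues` — the LEAD's assembly with THEOREM K's CONCLUSION as the only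
  non-elementary hypothesis (`hKum`); NO printed fact at all (the Atkin–Lehner fixedness is derived from `hKum` doubled).  Anyone who
  derives the Kummer values `σ(S_y) − S_y` by another road (e.g. analytically) gets E-es-185♭ from this theorem.
* §2 `indexFour_kummerDiamondReciprocity_of_even : T-es-75 → (c₀ even, index 4) → hKum` — THEOREM K in the LEAD's shape from
  T-es-75 ALONE, via the flat datum.
* §3 `shape185Flat_of_Tes75 : T-es-75 → E-es-185♭`; **`maninOddAtFour_of_CDT_Tes75 : CDT → T-es-75 → ManinOddAtFour`**;
  **`maninConstantOne_of_sixPrintedFacts : PrintedSemistableManinFacts → CDT → T-es-75 → ManinConstantOne`**.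

HONEST FRAMING: CONDITIONAL results.  The remaining printed inputs of C2 are CDT (Calegari–Dimitrov–Tang 2025 Thm 1.0.1) and T-es-75
(Stevens 1982 Thm 1.3.1 (b) for the optimal `X₁(N)`-parametrisation), both statement-only in the tree; the item C2 does not close BY
NAME as filed (ROUTE EDIT 3 would now need the binders {CDT, T-es-75} only).  BSD is not proved; Manin's conjecture is not proved.
No definitions, no sorry.  §1 is adapted verbatim from the LEAD's `two_pow_five_dvd_and_hasFreyTwistShape_of_index_four_of_twoTorsion`
and `map_atkinLehnerPoint_of_index_four` (p1 gen 20), with the two fact invocations replaced by the hypothesis `hKum`.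
[cite: Stevens1982, §1.3 Thm. 1.3.1] [cite: CalegariDimitrovTang2025, Thm. 1.0.1] [cite: Stevens1989, §2] [cite: SilvermanAEC2009, Prop. X.1.4]
-/

set_option autoImplicit false
-- lint-debt: the directory name repeats the summit name (sibling precedent `ManinLocalTwoThreeKummerDiamondIndexFourShapeFlat.lean`)
set_option linter.dupNamespace false

noncomputable section

open scoped Classical MatrixGroups
open Complex CongruenceSubgroup WeierstrassCurve WeierstrassCurve.Affine WeierstrassCurve.Affine.Point
open Literature.NumberTheory.EllipticCurves Literature.NumberTheory.EllipticCurves.ModularForms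
open Literature.NumberTheory.EllipticCurves.Greenberg1999 Literature.NumberTheory.Automorphic
open Summit.BirchSwinnertonDyer.Rank1Residual.ManinAdditive.KummerDiamond
open Summit.BirchSwinnertonDyer.BirchSwinnertonDyer.Theorems.ManinLocalTwoThree.KummerDiamondIndexFour

namespace Summit.BirchSwinnertonDyer.BirchSwinnertonDyer.Theorems.ManinLocalTwoThree.KummerDiamondIndexFourNoCES

/-! ## §1 The assembly with THEOREM K's conclusion as a hypothesis (no printed fact) -/

section Abstract

variable (W₀ : WeierstrassCurve ℚ) [W₀.IsElliptic] {N : ℕ} [NeZero N] (D₀ : ModularParametrizationData W₀ N)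

omit [W₀.IsElliptic] in
/-- **The Atkin–Lehner points `R_y = π₀(c₀{∞,1/y}_f)` are fixed by `Aut(ℂ/ℚ)` whenever the Kummer values of their halves `S_y` are the
`π₀(c₀{∞,γ∞}_f/2)`** (THEOREM K doubled: `2·π₀(c₀{∞,γ∞}/2) = π₀(c₀{∞,γ∞}) = 0`; the transport `γ` of diamond class `(d′ mod Q, 1 mod y)`
is es's `exists_gamma0_cusp_transport`).  Fact-free form of the LEAD's `map_atkinLehnerPoint_of_index_four`. [cite: Stevens1989, §2] -/
theorem map_atkinLehnerPoint_of_kummerValues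
    (hKum : ∀ (σ : ℂ ≃ₐ[ℚ] ℂ) (d d' : ℤ), ((d * d' : ℤ) : ZMod N) = 1 →
      σ (Complex.exp (2 * Real.pi * Complex.I / N)) = Complex.exp (2 * Real.pi * Complex.I * d / N) →
      ∀ (Q y : ℕ), Q * y = N → Nat.Coprime Q y → ∀ γ : Gamma0 N,
        (((γ : SL(2, ℤ)) 1 1 : ℤ) : ZMod Q) = (d' : ZMod Q) → (((γ : SL(2, ℤ)) 1 1 : ℤ) : ZMod y) = 1 →
        Affine.Point.map (W' := W₀) (σ : ℂ →ₐ[ℚ] ℂ) (D₀.uniformize ((D₀.c : ℂ) * modularSymbol D₀.f (1 / (y : ℚ)) / 2)) =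
          D₀.uniformize ((D₀.c : ℂ) * modularSymbol D₀.f (1 / (y : ℚ)) / 2) +
            D₀.uniformize ((D₀.c : ℂ) * cuspSymbol D₀.f γ / 2))
    (Q y : ℕ) (hQy : Q * y = N) (hcop : Nat.Coprime Q y) (σ : ℂ ≃ₐ[ℚ] ℂ) :
    Affine.Point.map (W' := W₀) (σ : ℂ →ₐ[ℚ] ℂ) (D₀.uniformize ((D₀.c : ℂ) * modularSymbol D₀.f (1 / (y : ℚ)))) =
      D₀.uniformize ((D₀.c : ℂ) * modularSymbol D₀.f (1 / (y : ℚ))) := by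
  obtain ⟨d, d', hdd', hσ⟩ := StepTwo.exists_inv_pair_of_algEquiv (N := N) σ
  have hd'cop : IsCoprime d' (N : ℤ) := by
    obtain ⟨k, hk⟩ := (ZMod.intCast_eq_intCast_iff_dvd_sub (d * d') 1 N).mp (by rw [hdd', Int.cast_one])
    exact ⟨d, k, by linear_combination -hk⟩
  obtain ⟨γ, hγQ, hγy, -, -⟩ := exists_gamma0_cusp_transport Q y hQy hcop d' hd'cop
  have hK := hKum σ d d' hdd' hσ Q y hQy hcop γ hγQ hγy
  have h2 : D₀.uniformize ((D₀.c : ℂ) * modularSymbol D₀.f (1 / (y : ℚ))) =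
      2 • D₀.uniformize ((D₀.c : ℂ) * modularSymbol D₀.f (1 / (y : ℚ)) / 2) := by
    rw [← map_nsmul]; congr 1; rw [nsmul_eq_mul]; push_cast; ring
  have hw2 : 2 • D₀.uniformize ((D₀.c : ℂ) * cuspSymbol D₀.f γ / 2) = 0 := by
    rw [← map_nsmul, D₀.uniformize_eq_zero_iff, nsmul_eq_mul,
      show ((2 : ℕ) : ℂ) * ((D₀.c : ℂ) * cuspSymbol D₀.f γ / 2) = (D₀.c : ℂ) * cuspSymbol D₀.f γ by push_cast; ring]
    exact D₀.smul_periodLattice_le _ (AddSubgroup.subset_closure ⟨γ, rfl⟩)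
  rw [h2, map_nsmul, hK, smul_add, hw2, add_zero]

/-- **`2⁵ ∣ N` and the Frey-twist shape for ONE lattice-optimal datum in the index-`4` world, given three rational `2`-torsion abscissae and
the KUMMER VALUES `σ(S_y) − S_y = π₀(c₀{∞,γ∞}_f/2)` of the cusp halves** (THEOREM K's conclusion, as a hypothesis) — the LEAD's assembly
`two_pow_five_dvd_and_hasFreyTwistShape_of_index_four_of_twoTorsion` (p1 gen 20) with its two printed-fact invocations replaced by `hKum`;
NO printed fact is used.  Chain: sorted roots → split `2`-torsion over `ℂ` → halving cocycles of `T₁`, `T₂` with their sign tables (LEAD D4)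
→ oddness at complex conjugation → Kummer subgroup (LEAD) → PROPOSITION A (p2 `StepTwo.propositionA_complex`, `hKum` supplying its values) →
readings (LEAD `DescentDictionary`) → D7 `hasFreyTwistShape_of_legendre_descent_cases`.
[cite: Stevens1989, §2] [cite: SilvermanAEC2009, Prop. X.1.4] -/
theorem two_pow_five_dvd_and_hasFreyTwistShape_of_kummerValues
    (hopt : ∀ z ∈ D₀.L.lattice, ∃ w ∈ periodLattice D₀.f, z = D₀.c * w)
    (h4 : ∀ z : ℂ, z ∈ periodLatticeGamma1 D₀.f ↔ ∃ w ∈ periodLattice D₀.f, z = 2 * w)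
    (h3 : ∃ x₁ x₂ x₃ : ℚ, x₁ ≠ x₂ ∧ x₁ ≠ x₃ ∧ x₂ ≠ x₃ ∧
      HasRationalTwoTorsionX W₀ x₁ ∧ HasRationalTwoTorsionX W₀ x₂ ∧ HasRationalTwoTorsionX W₀ x₃)
    (hKum : ∀ (σ : ℂ ≃ₐ[ℚ] ℂ) (d d' : ℤ), ((d * d' : ℤ) : ZMod N) = 1 →
      σ (Complex.exp (2 * Real.pi * Complex.I / N)) = Complex.exp (2 * Real.pi * Complex.I * d / N) →
      ∀ (Q y : ℕ), Q * y = N → Nat.Coprime Q y → ∀ γ : Gamma0 N,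
        (((γ : SL(2, ℤ)) 1 1 : ℤ) : ZMod Q) = (d' : ZMod Q) → (((γ : SL(2, ℤ)) 1 1 : ℤ) : ZMod y) = 1 →
        Affine.Point.map (W' := W₀) (σ : ℂ →ₐ[ℚ] ℂ) (D₀.uniformize ((D₀.c : ℂ) * modularSymbol D₀.f (1 / (y : ℚ)) / 2)) =
          D₀.uniformize ((D₀.c : ℂ) * modularSymbol D₀.f (1 / (y : ℚ)) / 2) +
            D₀.uniformize ((D₀.c : ℂ) * cuspSymbol D₀.f γ / 2)) :
    2 ^ 5 ∣ N ∧ HasFreyTwistShape W₀ := by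
  -- adapted from the LEAD's `…KummerDiamondIndexFourShapeFlat` (p1 gen 20): `hRfix` and THEOREM K now come from `hKum`
  have hRfix := map_atkinLehnerPoint_of_kummerValues W₀ D₀ hKum
  -- D1 as INPUT: three rational `2`-torsion abscissae, sorted, and the split `2`-torsion
  obtain ⟨x₁, x₂, x₃, h12, h13, h23, hx₁, hx₂, hx₃⟩ := h3
  obtain ⟨e₁, e₂, e₃, he₁₂, he₂₃, he₁, he₂, he₃⟩ := exists_sorted_twoTorsionX h12 h13 h23 hx₁ hx₂ hx₃
  have he₁₃ : e₁ < e₃ := he₁₂.trans he₂₃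
  have hsplit : W₀.toAffine.SplitTwoTorsion e₁ e₂ e₃ :=
    TwoTorsionNormalForm.splitTwoTorsion_of_three_twoTorsionX he₁₂.ne he₁₃.ne he₂₃.ne he₁ he₂ he₃
  have hC := HalvingCocycle.splitTwoTorsion_complex hsplit
  -- the Legendre model `y² = x(x − A)(x − B)`, `A = e₂ − e₁`, `B = e₃ − e₁`
  obtain ⟨C, hCW⟩ := TwoTorsionNormalForm.exists_variableChange_eq_legendre W₀ he₁₂.ne he₁₃.ne he₂₃.ne he₁ he₂ he₃
  have hA : (e₂ - e₁) ≠ 0 := sub_ne_zero.mpr he₁₂.ne'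
  have hB : (e₃ - e₁) ≠ 0 := sub_ne_zero.mpr he₁₃.ne'
  have hAB : (e₂ - e₁) ≠ (e₃ - e₁) := fun h ↦ he₂₃.ne (by linarith)
  -- the `2`-torsion points over `ℂ`
  set T₁ : (W₀.baseChange ℂ).toAffine.Point := .some _ _ (nonsingular_twoTorsion hC) with hT₁
  set T₂ : (W₀.baseChange ℂ).toAffine.Point := .some _ _ (nonsingular_twoTorsion hC.swap₁₂) with hT₂
  set T₃ : (W₀.baseChange ℂ).toAffine.Point := .some _ _ (nonsingular_twoTorsion hC.swap₂₃.swap₁₂) with hT₃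
  have hT₁0 : T₁ ≠ 0 := Affine.Point.some_ne_zero _
  have hT₂0 : T₂ ≠ 0 := Affine.Point.some_ne_zero _
  have hT₂₁ : T₂ ≠ T₁ := fun h ↦ hC.ne₁₂ (by rw [hT₂, hT₁, Affine.Point.some.injEq] at h; exact h.1.symm)
  have h2T₁ : (2 : ℕ) • T₁ = 0 := by rw [two_nsmul]; exact twoTorsion_add_self hC
  have h2T₂ : (2 : ℕ) • T₂ = 0 := by rw [two_nsmul]; exact twoTorsion_add_self hC.swap₁₂
  -- D4: the halving cocycles of `T₁`, `T₂`
  obtain ⟨Q₁, w₁, w₂, h2Q₁, hw₁, hw₂, hw₁0, hw₂0, htab₁⟩ := HalvingCocycle.exists_halvingCocycle_T₁ hC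
  obtain ⟨Q₂, w₁', w₂', h2Q₂, hw₁', hw₂', hw₁0', hw₂0', htab₂⟩ := HalvingCocycle.exists_halvingCocycle_T₂ hC
  have h2Q₁' : 2 • Q₁ = T₁ := by rw [two_nsmul]; exact h2Q₁
  have h2Q₂' : 2 • Q₂ = T₂ := by rw [two_nsmul]; exact h2Q₂
  have h4Q₁ : 2 • (2 • Q₁) = 0 := by rw [h2Q₁']; exact h2T₁
  have h4Q₂ : 2 • (2 • Q₂) = 0 := by rw [h2Q₂']; exact h2T₂
  -- signs of the descent pairs: `δ₁ > 0 > δ₂` for both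
  have hδ₁pos : (0 : ℚ) < (e₁ - e₂) * (e₁ - e₃) := mul_pos_of_neg_of_neg (by linarith) (by linarith)
  have hδ₂neg : e₁ - e₂ < (0 : ℚ) := by linarith
  have hδ₁pos' : (0 : ℚ) < e₂ - e₁ := by linarith
  have hδ₂neg' : (e₂ - e₁) * (e₂ - e₃) < (0 : ℚ) := mul_neg_of_pos_of_neg (by linarith) (by linarith)
  -- the two Kummer classes and their oddness: value `T₁` at complex conjugation
  set κ₁ : (ℂ ≃ₐ[ℚ] ℂ) → (W₀.baseChange ℂ).toAffine.Point := fun σ ↦ Affine.Point.map (W' := W₀) (σ : ℂ →ₐ[ℚ] ℂ) Q₁ - Q₁ with hκ₁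
  set κ₂ : (ℂ ≃ₐ[ℚ] ℂ) → (W₀.baseChange ℂ).toAffine.Point := fun σ ↦ Affine.Point.map (W' := W₀) (σ : ℂ →ₐ[ℚ] ℂ) Q₂ - Q₂ with hκ₂
  have htab₁' : ∀ σ : ℂ ≃ₐ[ℚ] ℂ, (κ₁ σ = 0 ∨ κ₁ σ = T₁ ∨ κ₁ σ = T₂ ∨ κ₁ σ = T₃) ∧ (σ w₁ = w₁ ↔ (κ₁ σ = 0 ∨ κ₁ σ = T₁)) ∧
      (σ w₂ = w₂ ↔ (κ₁ σ = 0 ∨ κ₁ σ = T₂)) := htab₁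
  have htab₂' : ∀ σ : ℂ ≃ₐ[ℚ] ℂ, (κ₂ σ = 0 ∨ κ₂ σ = T₁ ∨ κ₂ σ = T₂ ∨ κ₂ σ = T₃) ∧ (σ w₁' = w₁' ↔ (κ₂ σ = 0 ∨ κ₂ σ = T₁)) ∧
      (σ w₂' = w₂' ↔ (κ₂ σ = 0 ∨ κ₂ σ = T₂)) := htab₂
  have hodd₁ : κ₁ (Complex.conjAe.restrictScalars ℚ) = T₁ := DescentDictionary.cocycle_conj_eq κ₁ hδ₁pos hδ₂neg hw₁ hw₂ htab₁'
  have hodd₂ : κ₂ (Complex.conjAe.restrictScalars ℚ) = T₁ := DescentDictionary.cocycle_conj_eq κ₂ hδ₁pos' hδ₂neg' hw₁' hw₂' htab₂'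
  -- every `2`-torsion point is fixed
  have h2fix : ∀ S : (W₀.baseChange ℂ).toAffine.Point, 2 • S = 0 → ∀ σ : ℂ ≃ₐ[ℚ] ℂ,
      Affine.Point.map (W' := W₀) (σ : ℂ →ₐ[ℚ] ℂ) S = S := fun S hS σ ↦ twoTorsion_fixed hC D₀ S hS σ
  -- the Kummer subgroup (LEAD `exists_kummerSubgroup_cuspHalves_of_fixed`)
  obtain ⟨𝒱, h𝒱fin, h𝒱card, hmemR, hmem2⟩ := KummerSubgroup.exists_kummerSubgroup_cuspHalves_of_fixed D₀ h2fix hRfix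
  -- PROPOSITION A (p2 `propositionA_complex`) with the Kummer values `hKum` and the odd class `κ₁`
  obtain ⟨h32, p, a, b, y₂, yp, v, h₁, h₂, hp, hp2, hp4, ha5, hb1, hNa, -, hNp, -, hv0, -, -, -, -, hc₁, hc₂, -,
      hoddmem, -, -, h₂sq, h₂val, h₁mod8, h₁onto⟩ :=
    StepTwo.propositionA_complex D₀ hopt h4 𝒱 h𝒱fin h𝒱card
      (fun Q y hQy hcop ↦ ⟨_, hmemR Q y hQy hcop, fun σ d d' hdd' hσ γ hγQ hγy ↦ by
        show Affine.Point.map (W' := W₀) (σ : ℂ →ₐ[ℚ] ℂ) (D₀.uniformize ((D₀.c : ℂ) * modularSymbol D₀.f (1 / (y : ℚ)) / 2)) -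
            D₀.uniformize ((D₀.c : ℂ) * modularSymbol D₀.f (1 / (y : ℚ)) / 2) = D₀.uniformize ((D₀.c : ℂ) * cuspSymbol D₀.f γ / 2)
        rw [hKum σ d d' hdd' hσ Q y hQy hcop γ hγQ hγy, add_sub_cancel_left]⟩)
      ⟨κ₁, hmem2 Q₁ h4Q₁, by rw [hodd₁]; exact hT₁0⟩
  refine ⟨h32, ?_⟩
  have h8 : 8 ∣ N := ⟨2 ^ (a - 3) * y₂, by
    rw [← hNa, show (8 : ℕ) = 2 ^ 3 by norm_num, ← mul_assoc, ← pow_add, Nat.add_sub_cancel' (by omega : 3 ≤ a)]⟩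
  have hpN : p ∣ N := ⟨p ^ (b - 1) * yp, by
    rw [← hNp, ← mul_assoc, ← pow_succ', Nat.sub_add_cancel hb1]⟩
  -- membership of the two classes: each is `h₁` or `h₂`, and `v = T₁`
  have hκ₁mem : κ₁ = h₁ ∨ κ₁ = h₂ := hoddmem κ₁ (hmem2 Q₁ h4Q₁) (by rw [hodd₁]; exact hT₁0)
  have hκ₂mem : κ₂ = h₁ ∨ κ₂ = h₂ := hoddmem κ₂ (hmem2 Q₂ h4Q₂) (by rw [hodd₂]; exact hT₁0)
  have hv : v = T₁ := by
    rcases hκ₁mem with h | h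
    · rw [← hc₁, ← h]; exact hodd₁
    · rw [← hc₂, ← h]; exact hodd₁
  -- `κ(1) = 0` from the sign table (`1` fixes `w₁` and `w₂`)
  have hone : ∀ (κ : (ℂ ≃ₐ[ℚ] ℂ) → (W₀.baseChange ℂ).toAffine.Point) {u₁ u₂ : ℂ},
      (∀ σ : ℂ ≃ₐ[ℚ] ℂ, (κ σ = 0 ∨ κ σ = T₁ ∨ κ σ = T₂ ∨ κ σ = T₃) ∧ (σ u₁ = u₁ ↔ (κ σ = 0 ∨ κ σ = T₁)) ∧
        (σ u₂ = u₂ ↔ (κ σ = 0 ∨ κ σ = T₂))) → κ 1 = 0 := by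
    intro κ u₁ u₂ htab
    obtain ⟨-, t₁, t₂⟩ := htab 1
    rcases t₁.mp (AlgEquiv.one_apply u₁) with h | h
    · exact h
    · rcases t₂.mp (AlgEquiv.one_apply u₂) with h' | h'
      · exact h'
      · exact absurd (h.symm.trans h') hT₂₁.symm
  have hpQ : (-(p : ℚ)) ≠ 0 := neg_ne_zero.mpr (by exact_mod_cast hp.ne_zero)
  -- reading of a class equal to `h₂`
  have read₂ : ∀ (κ : (ℂ ≃ₐ[ℚ] ℂ) → (W₀.baseChange ℂ).toAffine.Point) {δ₁ δ₂ : ℚ}, δ₁ ≠ 0 → δ₂ ≠ 0 → ∀ {u₁ u₂ : ℂ},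
      u₁ ^ 2 = (δ₁ : ℂ) → u₂ ^ 2 = (δ₂ : ℂ) →
      (∀ σ : ℂ ≃ₐ[ℚ] ℂ, (κ σ = 0 ∨ κ σ = T₁ ∨ κ σ = T₂ ∨ κ σ = T₃) ∧ (σ u₁ = u₁ ↔ (κ σ = 0 ∨ κ σ = T₁)) ∧
        (σ u₂ = u₂ ↔ (κ σ = 0 ∨ κ σ = T₂))) →
      κ = h₂ → sqClass δ₁ = 1 ∧ sqClass δ₂ = sqClass (-(p : ℚ)) := by
    intro κ δ₁ δ₂ hδ₁ hδ₂ u₁ u₂ hu₁ hu₂ htab hκ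
    rw [hκ] at htab
    refine DescentDictionary.reading_of_h₂ (N := N) hp hp4 hpN hT₂0 hT₂₁ h₂ hδ₂ hu₁ hu₂ (fun σ ↦ (htab σ).2.1)
      (fun σ ↦ (htab σ).2.2) (fun σ ↦ ?_) h₂sq
    rcases h₂val σ with h | h
    · exact Or.inl h
    · exact Or.inr (h.trans hv)
  -- reading of a class equal to `h₁`, with a chosen `σ₂`
  have read₁ : ∀ (κ : (ℂ ≃ₐ[ℚ] ℂ) → (W₀.baseChange ℂ).toAffine.Point) {δ₁ δ₂ : ℚ}, δ₁ ≠ 0 → δ₂ ≠ 0 → ∀ {u₁ u₂ : ℂ},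
      u₁ ^ 2 = (δ₁ : ℂ) → u₂ ^ 2 = (δ₂ : ℂ) →
      (∀ σ : ℂ ≃ₐ[ℚ] ℂ, (κ σ = 0 ∨ κ σ = T₁ ∨ κ σ = T₂ ∨ κ σ = T₃) ∧ (σ u₁ = u₁ ↔ (κ σ = 0 ∨ κ σ = T₁)) ∧
        (σ u₂ = u₂ ↔ (κ σ = 0 ∨ κ σ = T₂))) →
      κ 1 = 0 → κ (Complex.conjAe.restrictScalars ℚ) = T₁ → κ = h₁ →
      ∃ (σ₂ : ℂ ≃ₐ[ℚ] ℂ) (d₂ d₂' : ℤ), ((d₂ * d₂' : ℤ) : ZMod N) = 1 ∧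
        σ₂ (exp (2 * Real.pi * I / N)) = exp (2 * Real.pi * I * d₂ / N) ∧ h₁ σ₂ = T₂ ∧
        ((d₂ : ZMod 8) = 3 ∨ (d₂ : ZMod 8) = 5) ∧
        sqClass δ₁ = sqClass (2 : ℚ) ∧ ((d₂ : ZMod 8) = 5 → sqClass δ₂ = sqClass (-1 : ℚ)) ∧
          ((d₂ : ZMod 8) = 3 → sqClass δ₂ = sqClass (-2 : ℚ)) := by
    intro κ δ₁ δ₂ hδ₁ hδ₂ u₁ u₂ hu₁ hu₂ htab hκ1 hκc hκ
    rw [hκ] at htab hκ1 hκc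
    obtain ⟨σ₂, hσ₂⟩ := DescentDictionary.exists_hit_T₂ h₁ _ (StepTwo.four_le_ncard_range_uniformize_half_cuspSymbol D₀ hopt) h₁onto
      (fun σ ↦ (htab σ).1)
    obtain ⟨d₂, d₂', hdd₂, hσ₂'⟩ := StepTwo.exists_inv_pair_of_algEquiv (N := N) σ₂
    have hres := DescentDictionary.residue_of_T₂ (N := N) h8 hT₂0 hT₂₁ h₁ h₁mod8 hκ1 hκc hdd₂ hσ₂' hσ₂
    obtain ⟨r₁, r₅, r₃⟩ := DescentDictionary.reading_of_h₁ (N := N) h8 h₁ hδ₁ hδ₂ hu₁ hu₂ (fun σ ↦ (htab σ).2.1)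
      (fun σ ↦ (htab σ).2.2) h₁mod8 hκ1 hκc hdd₂ hσ₂' hσ₂
    exact ⟨σ₂, d₂, d₂', hdd₂, hσ₂', hσ₂, hres, r₁, r₅, r₃⟩
  -- the square-class identities `δ(T₁) = (AB, −A)`, `δ(T₂) = (A, A(A−B))`
  have eAB : (e₂ - e₁) * (e₃ - e₁) = (e₁ - e₂) * (e₁ - e₃) := by ring
  have enA : -(e₂ - e₁) = e₁ - e₂ := by ring
  have eAAB : (e₂ - e₁) * ((e₂ - e₁) - (e₃ - e₁)) = (e₂ - e₁) * (e₂ - e₃) := by ring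
  have hδ₁ : (e₁ - e₂) * (e₁ - e₃) ≠ 0 := hδ₁pos.ne'
  have hδ₂ : e₁ - e₂ ≠ 0 := hδ₂neg.ne
  have hδ₁' : e₂ - e₁ ≠ 0 := hδ₁pos'.ne'
  have hδ₂' : (e₂ - e₁) * (e₂ - e₃) ≠ 0 := hδ₂neg'.ne
  -- choose the common `δ` and conclude by D7
  by_cases H : ∃ (σ : ℂ ≃ₐ[ℚ] ℂ) (d d' : ℤ), ((d * d' : ℤ) : ZMod N) = 1 ∧
      σ (exp (2 * Real.pi * I / N)) = exp (2 * Real.pi * I * d / N) ∧ h₁ σ = T₂ ∧ (d : ZMod 8) = 5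
  · -- `δ = [−1]`
    obtain ⟨σ₅, d₅, d₅', hdd₅, hσ₅, hκ₅, h5⟩ := H
    have key : ∀ (κ : (ℂ ≃ₐ[ℚ] ℂ) → (W₀.baseChange ℂ).toAffine.Point) {δ₁ δ₂ : ℚ}, δ₁ ≠ 0 → δ₂ ≠ 0 → ∀ {u₁ u₂ : ℂ},
        u₁ ^ 2 = (δ₁ : ℂ) → u₂ ^ 2 = (δ₂ : ℂ) →
        (∀ σ : ℂ ≃ₐ[ℚ] ℂ, (κ σ = 0 ∨ κ σ = T₁ ∨ κ σ = T₂ ∨ κ σ = T₃) ∧ (σ u₁ = u₁ ↔ (κ σ = 0 ∨ κ σ = T₁)) ∧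
          (σ u₂ = u₂ ↔ (κ σ = 0 ∨ κ σ = T₂))) →
        κ 1 = 0 → κ (Complex.conjAe.restrictScalars ℚ) = T₁ → (κ = h₁ ∨ κ = h₂) →
        (sqClass δ₁ = sqClass (2 : ℚ) ∧ sqClass δ₂ = sqClass (-1 : ℚ)) ∨ (sqClass δ₁ = 1 ∧ sqClass δ₂ = sqClass (-(p : ℚ))) := by
      intro κ δ₁ δ₂ hδ₁ hδ₂ u₁ u₂ hu₁ hu₂ htab hκ1 hκc hκ
      rcases hκ with hκ | hκ
      · left
        rw [hκ] at htab hκ1 hκc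
        obtain ⟨r₁, r₅, -⟩ := DescentDictionary.reading_of_h₁ (N := N) h8 h₁ hδ₁ hδ₂ hu₁ hu₂ (fun σ ↦ (htab σ).2.1)
          (fun σ ↦ (htab σ).2.2) h₁mod8 hκ1 hκc hdd₅ hσ₅ hκ₅
        exact ⟨r₁, r₅ h5⟩
      · right; exact read₂ κ hδ₁ hδ₂ hu₁ hu₂ htab hκ
    have k₁ := key κ₁ hδ₁ hδ₂ hw₁ hw₂ htab₁' (hone κ₁ htab₁') hodd₁ hκ₁mem
    have k₂ := key κ₂ hδ₁' hδ₂' hw₁' hw₂' htab₂' (hone κ₂ htab₂') hodd₂ hκ₂mem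
    refine KummerDiamondCases.hasFreyTwistShape_of_legendre_descent_cases W₀ hCW hA hB hAB hp hp4 (sqClass (-1 : ℚ)) ?_ ?_
    · rw [eAB, enA]; exact k₁
    · rw [eAAB]; exact k₂
  · -- `δ = [−2]`
    have key : ∀ (κ : (ℂ ≃ₐ[ℚ] ℂ) → (W₀.baseChange ℂ).toAffine.Point) {δ₁ δ₂ : ℚ}, δ₁ ≠ 0 → δ₂ ≠ 0 → ∀ {u₁ u₂ : ℂ},
        u₁ ^ 2 = (δ₁ : ℂ) → u₂ ^ 2 = (δ₂ : ℂ) →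
        (∀ σ : ℂ ≃ₐ[ℚ] ℂ, (κ σ = 0 ∨ κ σ = T₁ ∨ κ σ = T₂ ∨ κ σ = T₃) ∧ (σ u₁ = u₁ ↔ (κ σ = 0 ∨ κ σ = T₁)) ∧
          (σ u₂ = u₂ ↔ (κ σ = 0 ∨ κ σ = T₂))) →
        κ 1 = 0 → κ (Complex.conjAe.restrictScalars ℚ) = T₁ → (κ = h₁ ∨ κ = h₂) →
        (sqClass δ₁ = sqClass (2 : ℚ) ∧ sqClass δ₂ = sqClass (-2 : ℚ)) ∨ (sqClass δ₁ = 1 ∧ sqClass δ₂ = sqClass (-(p : ℚ))) := by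
      intro κ δ₁ δ₂ hδ₁ hδ₂ u₁ u₂ hu₁ hu₂ htab hκ1 hκc hκ
      rcases hκ with hκ | hκ
      · left
        obtain ⟨σ₂, d₂, d₂', hdd₂, hσ₂', hσ₂, hres, r₁, -, r₃⟩ := read₁ κ hδ₁ hδ₂ hu₁ hu₂ htab hκ1 hκc hκ
        have h3 : (d₂ : ZMod 8) = 3 := by
          rcases hres with h | h
          · exact h
          · exact absurd ⟨σ₂, d₂, d₂', hdd₂, hσ₂', hσ₂, h⟩ H
        exact ⟨r₁, r₃ h3⟩
      · right; exact read₂ κ hδ₁ hδ₂ hu₁ hu₂ htab hκ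
    have k₁ := key κ₁ hδ₁ hδ₂ hw₁ hw₂ htab₁' (hone κ₁ htab₁') hodd₁ hκ₁mem
    have k₂ := key κ₂ hδ₁' hδ₂' hw₁' hw₂' htab₂' (hone κ₂ htab₂') hodd₂ hκ₂mem
    refine KummerDiamondCases.hasFreyTwistShape_of_legendre_descent_cases W₀ hCW hA hB hAB hp hp4 (sqClass (-2 : ℚ)) ?_ ?_
    · rw [eAB, enA]; exact k₁
    · rw [eAAB]; exact k₂

end Abstract

/-! ## §2 THEOREM K from T-es-75 alone, via the flat `X₁(N)`-datum -/

section Flat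

variable (W₀ : WeierstrassCurve ℚ) [W₀.IsElliptic] {N : ℕ} [NeZero N] (D₀ : ModularParametrizationData W₀ N)

/-- **THEOREM K in the index-`4`, `c₀`-even world, from T-es-75 ALONE** (same conclusion as es's `indexFour_kummerDiamondReciprocity`, without
CES): the `X₀(N)`-optimal curve itself carries an optimal `X₁(N)`-datum `D₁` with `D₁.f = D₀.f`, `D₁.uniformize = D₀.uniformize`,
`2·D₁.c = D₀.c` (`FlatGamma1Datum.exists_flat_gamma1ParametrizationData`), and THEOREM K♮ (es `kummerDiamondReciprocity`, ⟸ T-es-75) on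
`D₁` reads `σ(π₀(c₀ s/2)) = π₀(c₀ s/2) + π₀(c₀{∞,γ∞}/2)` verbatim.  [cite: Stevens1982, §1.3 Thm. 1.3.1 (b)] [cite: Stevens1989, §2] -/
theorem indexFour_kummerDiamondReciprocity_of_even (hSt : optimalGamma1Parametrization_cuspInv_galoisAction)
    (hopt : ∀ z ∈ D₀.L.lattice, ∃ w ∈ periodLattice D₀.f, z = D₀.c * w) (heven : (2 : ℤ) ∣ D₀.c)
    (h4 : ∀ z : ℂ, z ∈ periodLatticeGamma1 D₀.f ↔ ∃ w ∈ periodLattice D₀.f, z = 2 * w)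
    (σ : ℂ ≃ₐ[ℚ] ℂ) (d d' : ℤ) (hdd' : ((d * d' : ℤ) : ZMod N) = 1)
    (hσ : σ (Complex.exp (2 * Real.pi * Complex.I / N)) = Complex.exp (2 * Real.pi * Complex.I * d / N))
    (Q y : ℕ) (hQy : Q * y = N) (hcop : Nat.Coprime Q y) (γ : Gamma0 N)
    (hγQ : (((γ : SL(2, ℤ)) 1 1 : ℤ) : ZMod Q) = (d' : ZMod Q)) (hγy : (((γ : SL(2, ℤ)) 1 1 : ℤ) : ZMod y) = 1) :
    Affine.Point.map (W' := W₀) (σ : ℂ →ₐ[ℚ] ℂ) (D₀.uniformize ((D₀.c : ℂ) * modularSymbol D₀.f (1 / (y : ℚ)) / 2)) =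
      D₀.uniformize ((D₀.c : ℂ) * modularSymbol D₀.f (1 / (y : ℚ)) / 2) +
        D₀.uniformize ((D₀.c : ℂ) * cuspSymbol D₀.f γ / 2) := by
  obtain ⟨D₁, hD₁, hf, -, hu, hc⟩ := FlatGamma1Datum.exists_flat_gamma1ParametrizationData D₀ hopt heven h4
  have hK := kummerDiamondReciprocity hSt W₀ D₁ hD₁ σ d d' hdd' hσ Q y hQy hcop γ hγQ hγy
  rw [hf, hu] at hK
  have hcc : (D₀.c : ℂ) = 2 * (D₁.c : ℂ) := by rw [← hc]; push_cast; ring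
  have e1 : (D₀.c : ℂ) * modularSymbol D₀.f (1 / (y : ℚ)) / 2 = (D₁.c : ℂ) * modularSymbol D₀.f (1 / (y : ℚ)) := by
    rw [hcc]; ring
  have e2 : (D₀.c : ℂ) * cuspSymbol D₀.f γ / 2 = (D₁.c : ℂ) * cuspSymbol D₀.f γ := by
    rw [hcc]; ring
  rw [e1, e2]
  exact hK

/-- **The Atkin–Lehner points are fixed in the index-`4`, `c₀`-even world, from T-es-75 ALONE** (the LEAD's `map_atkinLehnerPoint_of_index_four`
without CES). [cite: Stevens1982, §1.3 Thm. 1.3.1 (b)] [cite: Stevens1989, §2] -/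
theorem map_atkinLehnerPoint_of_even (hSt : optimalGamma1Parametrization_cuspInv_galoisAction)
    (hopt : ∀ z ∈ D₀.L.lattice, ∃ w ∈ periodLattice D₀.f, z = D₀.c * w) (heven : (2 : ℤ) ∣ D₀.c)
    (h4 : ∀ z : ℂ, z ∈ periodLatticeGamma1 D₀.f ↔ ∃ w ∈ periodLattice D₀.f, z = 2 * w)
    (Q y : ℕ) (hQy : Q * y = N) (hcop : Nat.Coprime Q y) (σ : ℂ ≃ₐ[ℚ] ℂ) :
    Affine.Point.map (W' := W₀) (σ : ℂ →ₐ[ℚ] ℂ) (D₀.uniformize ((D₀.c : ℂ) * modularSymbol D₀.f (1 / (y : ℚ)))) =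
      D₀.uniformize ((D₀.c : ℂ) * modularSymbol D₀.f (1 / (y : ℚ))) :=
  map_atkinLehnerPoint_of_kummerValues W₀ D₀ (indexFour_kummerDiamondReciprocity_of_even W₀ D₀ hSt hopt heven h4) Q y hQy hcop σ

/-- **`2⁵ ∣ N` and the Frey-twist shape for ONE lattice-optimal datum with `c₀` even in the index-`4` world, given three rational `2`-torsion
abscissae — from T-es-75 ALONE** (no CES, no F★). [cite: Stevens1982, §1.3 Thm. 1.3.1 (b)] [cite: Stevens1989, §2] -/
theorem two_pow_five_dvd_and_hasFreyTwistShape_of_even_of_twoTorsion (hSt : optimalGamma1Parametrization_cuspInv_galoisAction)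
    (hopt : ∀ z ∈ D₀.L.lattice, ∃ w ∈ periodLattice D₀.f, z = D₀.c * w) (heven : (2 : ℤ) ∣ D₀.c)
    (h4 : ∀ z : ℂ, z ∈ periodLatticeGamma1 D₀.f ↔ ∃ w ∈ periodLattice D₀.f, z = 2 * w)
    (h3 : ∃ x₁ x₂ x₃ : ℚ, x₁ ≠ x₂ ∧ x₁ ≠ x₃ ∧ x₂ ≠ x₃ ∧
      HasRationalTwoTorsionX W₀ x₁ ∧ HasRationalTwoTorsionX W₀ x₂ ∧ HasRationalTwoTorsionX W₀ x₃) :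
    2 ^ 5 ∣ N ∧ HasFreyTwistShape W₀ :=
  two_pow_five_dvd_and_hasFreyTwistShape_of_kummerValues W₀ D₀ hopt h4 h3
    (indexFour_kummerDiamondReciprocity_of_even W₀ D₀ hSt hopt heven h4)

end Flat

/-! ## §3 E-es-185♭ and C2 modulo {CDT, T-es-75}; the whole route modulo six printed facts -/

/-- **E-es-185♭ ⟸ T-es-75** (p3's flat binder shape: `|c₀| = 2` and the rational `2`-torsion as inputs; `|c₀| = 2` is used only through
`2 ∣ c₀`). [cite: Stevens1982, §1.3 Thm. 1.3.1 (b)] -/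
theorem shape185Flat_of_Tes75 (hSt : optimalGamma1Parametrization_cuspInv_galoisAction) :
    ∀ (W₀ : WeierstrassCurve ℚ) [W₀.IsElliptic] [W₀.IsGloballyMinimal] {N : ℕ} [NeZero N] (D₀ : ModularParametrizationData W₀ N),
      (∀ z ∈ D₀.L.lattice, ∃ w ∈ periodLattice D₀.f, z = D₀.c * w) → D₀.c.natAbs = 2 →
      (∀ z : ℂ, z ∈ periodLatticeGamma1 D₀.f ↔ ∃ w ∈ periodLattice D₀.f, z = 2 * w) →
      (∃ x₁ x₂ x₃ : ℚ, x₁ ≠ x₂ ∧ x₁ ≠ x₃ ∧ x₂ ≠ x₃ ∧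
        HasRationalTwoTorsionX W₀ x₁ ∧ HasRationalTwoTorsionX W₀ x₂ ∧ HasRationalTwoTorsionX W₀ x₃) →
      2 ^ 5 ∣ N ∧ HasFreyTwistShape W₀ := by
  intro W₀ _ _ _ _ D₀ hopt hc2 h4 h3
  have heven : (2 : ℤ) ∣ D₀.c := by
    rw [← Int.natAbs_dvd_natAbs]
    simp [hc2]
  exact two_pow_five_dvd_and_hasFreyTwistShape_of_even_of_twoTorsion W₀ D₀ hSt hopt heven h4 h3

/-- **C2 `ManinOddAtFour` ⟸ CDT ∧ T-es-75** (TWO printed, statement-only facts; CONDITIONAL; CES and F★ are not needed; via p3's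
`CDivTranslate.maninOddAtFour_of_CDTInt_shape185Flat`). [cite: CalegariDimitrovTang2025, Thm. 1.0.1] [cite: Stevens1982, §1.3 Thm. 1.3.1 (b)] -/
theorem maninOddAtFour_of_CDT_Tes75 (hCDT : CalegariDimitrovTang2025_unboundedDenominators)
    (hSt : optimalGamma1Parametrization_cuspInv_galoisAction) :
    Summit.BirchSwinnertonDyer.BirchSwinnertonDyer.Theses.ManinLocalTwoThree.ManinOddAtFour :=
  CDivTranslate.maninOddAtFour_of_CDTInt_shape185Flat hCDT (shape185Flat_of_Tes75 hSt)

/-- **Manin's conjecture `ManinConstantOne` ⟸ six printed facts** (the whole route `ManinLocalTwoThree` through its `closes`: Mazur 1978 Cor 4.1,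
Abbes–Ullmo 1996 Thm A, Česnavičius 2018 Thm 1.2, modularity — bundled as `PrintedSemistableManinFacts` — plus Calegari–Dimitrov–Tang 2025
Thm 1.0.1 and Stevens 1982 Thm 1.3.1 (b) (T-es-75); CONDITIONAL; BSD is not proved; Manin's conjecture is not proved unconditionally).
[cite: CalegariDimitrovTang2025, Thm. 1.0.1] [cite: Stevens1982, §1.3 Thm. 1.3.1 (b)] [cite: Cesnavicius2018, Thm. 1.2] -/
theorem maninConstantOne_of_sixPrintedFacts
    (hPF : Summit.BirchSwinnertonDyer.BirchSwinnertonDyer.Theses.ManinLocalTwoThree.PrintedSemistableManinFacts)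
    (hCDT : CalegariDimitrovTang2025_unboundedDenominators) (hSt : optimalGamma1Parametrization_cuspInv_galoisAction) :
    Summit.BirchSwinnertonDyer.Rank1Residual.ManinConstant.ManinConstantOne :=
  CDivTranslate.maninConstantOne_of_printedFacts_CDTInt_shape185Flat hPF hCDT (shape185Flat_of_Tes75 hSt)

end Summit.BirchSwinnertonDyer.BirchSwinnertonDyer.Theorems.ManinLocalTwoThree.KummerDiamondIndexFourNoCES

end
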